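import Literature.AlgebraicGeometry.AbelianSchemes.CechH1CountOfPoincareDataHead
import Literature.AlgebraicGeometry.AbelianSchemes.DualPairDimEq
import Literature.AlgebraicGeometry.AbelianSchemes.AbelianSchemeKOfLSeesaw
import HarnessLib

/-!
# `dim_k Ȟ¹(𝔘, 𝒪_B) = dim B` FOR EVERY ABELIAN VARIETY, ANY CHARACTERISTIC — REDUCED TO FLAT POINCARÉ DATA OVER ALGEBRAICALLY CLOSED FIELDS
# ([MumfordAV1970] §13 Cor. 2 via the quotient `Â = A⁄K(L)` by the FINITE (not necessarily étale) group scheme `K(L)`, §12 Thm. 1)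

Layer `Literature/AlgebraicGeometry/AbelianSchemes`, namespaces `Literature.AlgebraicGeometry.AbelianSchemes.AbelianSchemeOver` (§1–§3) and
`Literature.AlgebraicGeometry.AbelianSchemes.MumfordDual` (§4).  THEOREMS ONLY (no definition, no named fact, no instance, no notation, no `sorry`).
Cell `hodgecm-mathlib` (D-0151), P6 «MOD programme», sub-desk P6b (MOD-PLAN v0.9 Row 4), organ (O4) «FLATQUOT» of the banked socket
`stub_L4B1u_abelianLiftOfIsUnitTwo` (`Cruxes/HLiu418/Lines/F0_P6b_BTSerreTate.lean` §1, junction §1b `stub_L4B1u_of_cechH1Count`): the `H¹`-count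
`dim B ≤ dim_k Ȟ¹(𝔘, 𝒪_B) + 1` for EVERY abelian variety `B` over EVERY field `k`.  The ★ road of `CechH1CountOfPoincareDataHead` pays this count only
when some `n ∈ k^×` kills `K(L)` (separable polarisation; `K(L)` finite ÉTALE, Mumford's construction by a CONSTANT group ★ `MumfordQuotientConstruction*`),
which fails in characteristic `p` in general.  This file isolates exactly what the general case needs and pays everything around it:

* §1 `exists_rankOne_rigidified_isAmple_geometricFibre` — on every abelian scheme `A → Spec k` over a FIELD there is a rank-one `L = 𝒪(Θ)` (★
  `AbelianVariety.exists_isAmple_symmetric_holds`, [MumfordAV1970] §6 Application 1, §17), rigidified along the unit section for free (★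
  `CechPic.pullback_eq_one_of_isLocalRing`), whose class on every geometric fibre `A_Ω` is the class of the AMPLE Cartier divisor `pr₁^*Θ`
  (★ `CartierDivisor.cechClass_pullback`, ★ `detClass_lineBundle_toUnitCocycle`) — the (P1) recipe of ★ `DualPairDimEq.dim_le_dim_hat`, any characteristic.
* §2 `exists_rankOne_kOfL_closedSubgroup` — for that `L`, `K(L) ⊆ A` IS a FINITE CLOSED SUBGROUP SCHEME: a closed immersion `i : Z ↪ A` with `Z → Spec k`
  finite representing `K(L)` (★ `exists_isClosedImmersion_isFinite_iff_memKOfL_of_isNoetherianRing`, [MumfordAV1970] §13 (p. 123), [GortzWedhorn2023]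
  Thm. 24.66), stable under unit, product and inverse (★ `exists_one_mul_inv_fac_of_memKOfL`).  No `n ∈ k^×`, no étaleness.
* §3 `finite_finrank_cechH1_eq_of_poincareData_of_flat` — the HEAD ★ `finite_finrank_cechH1_eq_of_poincareData` ([MumfordAV1970] §13 Cor. 2 from the
  Poincaré family, B-p04 (g42)) with its four structural instance binders on `A → Spec K` discharged from `AbelianSchemeOver` and `π : A → Â` merely a FLAT
  surjective homomorphism (the shape of `A → A⁄K(L)` when `K(L)` is not étale, [MumfordAV1970] §12 Thm. 1 (p. 111)).
* §4 `MumfordDual.finite_finrank_cechH1_eq_dim_of_forall_flatPoincareData` ∕ `MumfordDual.hH1_of_forall_flatPoincareData` — (DESC) ★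
  `finrank_cechH1_structureSheaf_eq_dim_of_algClosure` ([StacksProject] Tag 02KH): IF every abelian scheme over every ALGEBRAICALLY CLOSED field (of
  relative dimension `g`) carries flat Poincaré data `(L, Â, π, 𝒫)` — `L` rank one rigidified, `π : A → Â` a flat surjective homomorphism onto an abelian
  scheme of relative dimension `g` with kernel `K(L)`, `𝒫` rank one on `A × Â` with `(1 × π)^*𝒫 ≅ Λ(L)` and every slice `𝒫|_{A × {b}}` in `Pic⁰` (the
  output of [MumfordAV1970] §13 Theorem (p. 125) for `Â := A⁄K(L)`) — THEN for every abelian scheme `B` over EVERY field `k` and every finite affine open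
  cover `𝔘` of `B`, `Ȟ¹(𝔘, 𝒪_B)` is finite of rank `dim B`; in particular the letter `dim B ≤ dim_k Ȟ¹(𝔘, 𝒪_B) + 1` of junction §1b VERBATIM.

HONEST LABEL.  The hypothesis of §4 («flat Poincaré data over `k = k̄`») is NOT proved here: it is [MumfordAV1970] §12 Thm. 1 (quotient of `A` by the finite
group scheme `K(L)` of §2) + §13 Theorem (descent of `Λ(L)` to `A × A⁄K(L)`), the two stubs of the sub-line `Lines/F0_P6b_MumfordDualFlat.lean`; §1–§3 are
unconditional.  HC_CM is proved only modulo the printed citations (2 remaining named inputs hLiu418 24832, h413 24833) until rung 0 closes; this file is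
count-neutral ★ capital and asserts nothing about HC.

## References
* [MumfordAV1970] D. Mumford, *Abelian Varieties* (1970), §6 Application 1 (p. 60); §12 Thm. 1 (p. 111); §13 (p. 123), Theorem (p. 125), its proof
  (pp. 125–129) and Cor. 2 (p. 129); §17 (p. 163).
* [GortzWedhorn2023] U. Görtz, T. Wedhorn, *Algebraic Geometry II* (2023), Thm. 24.66; Thm. 27.68 and Prop. 27.62; Cor. 27.177 (1).
* [StacksProject] The Stacks Project, Tag 02KH (flat base change of Čech cohomology).
* [MumfordFogartyKirwan1994] D. Mumford, J. Fogarty, F. Kirwan, *Geometric Invariant Theory*, 3rd ed. (1994), Ch. 6 §2 Definition 6.2 (p. 120).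
-/

set_option autoImplicit false

noncomputable section

-- `Scheme.Modules` / cartesian-monoidal `Over` products / `AbelianVariety.baseChange` vs `AbelianSchemeOver.baseChange` agree only at default
-- transparency (as in ★ `CechH1DimOfPoincareData`, ★ `CechH1CountOfPoincareDataHead`).
set_option backward.isDefEq.respectTransparency false

open CategoryTheory CategoryTheory.Limits AlgebraicGeometry MonoidalCategory CartesianMonoidalCategory
open scoped MonObj
open Literature.AlgebraicGeometry.AbelianSchemes Literature.AlgebraicGeometry.Motives Literature.AlgebraicGeometry.AbelianVarieties
open Literature.AlgebraicGeometry.Modules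
open Literature.AlgebraicGeometry.Morphisms (CechH1)

namespace Literature.AlgebraicGeometry.AbelianSchemes

namespace AbelianSchemeOver

/-! ## §1 A rigidified rank-one `L = 𝒪(Θ)` with ample class on every geometric fibre, on any abelian scheme over a field -/

/-- **On an abelian scheme `A → Spec k` over a field there is a rank-one `L`, rigidified along the unit section, whose class on every geometric fibre
`A_Ω` (`Ω` algebraically closed) is the class of an AMPLE Cartier divisor**: `L := 𝒪(Θ)` for an ample `Θ` on `A` ([MumfordAV1970] §6 Application 1,
§17; ★ `AbelianVariety.exists_isAmple_symmetric_holds`), rigidified for free over the local base (★ `CechPic.pullback_eq_one_of_isLocalRing`), and on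
`A_Ω` the class of `L` is the class of `pr₁^*Θ`, ample (★ `CartierDivisor.IsAmple.pullback` along the affine dominant `pr₁`).  The (P1) recipe of ★
`DualPairDimEq.dim_le_dim_hat`, any characteristic. [cite: MumfordAV1970, §6 Application 1 (p. 60) and §17 (p. 163)]
[cite: MumfordFogartyKirwan1994, Ch. 6 §2 Definition 6.2 (p. 120)] -/
theorem exists_rankOne_rigidified_isAmple_geometricFibre (k : Type) [Field k] (A : AbelianSchemeOver (Spec (.of k))) :
    ∃ (L : A.left.Modules) (hL : HasRank L 1),
      CechPic.pullback A.unitSection (detClass (HasRank.isFiniteLocallyFree' hL)) = 1 ∧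
      ∀ ⦃Ω : Type⦄ [Field Ω] [IsAlgClosed Ω] (s : Spec (.of Ω) ⟶ Spec (.of k)),
        ∃ Θ : CartierDivisor (A.fibre s).toAbelianVariety.X.left, Θ.IsAmple ∧
          CechPic.pullback (X := (A.fibre s).toAbelianVariety.X.left) (pullback.fst A.X.hom s)
            (detClass (HasRank.isFiniteLocallyFree' hL)) = Θ.cechClass := by
  -- an ample divisor `Θ` on the abelian variety `A`, `L = 𝒪(Θ)`, rigidified for free over the field base
  obtain ⟨Θ, hΘ, -⟩ := (AbelianVariety.exists_isAmple_symmetric_holds (A := A.toAffine.toAbelianVariety))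
  have hL : HasRank (Modules.lineBundle Θ.toUnitCocycle : A.left.Modules) 1 := UnitCocycle.hasRank_lineBundle _
  have hε : CechPic.pullback A.unitSection (detClass (HasRank.isFiniteLocallyFree' hL)) = 1 :=
    CechPic.pullback_eq_one_of_isLocalRing _ _
  refine ⟨_, hL, hε, ?_⟩
  intro Ω _ _ s
  -- the geometric point `s` is surjective (one-point target), so `pr₁ : A_Ω → A` is affine and dominant
  haveI : Subsingleton ↥(Spec (CommRingCat.of k)) := inferInstanceAs (Subsingleton (PrimeSpectrum k))
  haveI : Surjective s := ⟨fun _ => ⟨(⟨⊥, Ideal.isPrime_bot⟩ : PrimeSpectrum Ω), Subsingleton.elim _ _⟩⟩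
  have hd : IsDominant (pullback.fst A.X.hom s) := inferInstance
  have haff : IsAffineHom (pullback.fst A.X.hom s) := MorphismProperty.pullback_fst _ _ inferInstance
  haveI : @IsDominant ((A.fibre s).toAbelianVariety.X.left) A.toAffine.toAbelianVariety.X.left (pullback.fst A.X.hom s) := hd
  haveI : @IsAffineHom ((A.fibre s).toAbelianVariety.X.left) A.toAffine.toAbelianVariety.X.left (pullback.fst A.X.hom s) := haff
  -- the ample divisor `pr₁^*Θ` on the fibre `A_Ω` (fibre spelling of the source, so that `IsIntegral` is found)
  obtain ⟨Θs, hΘs_def⟩ : ∃ Θs : CartierDivisor (A.fibre s).toAbelianVariety.X.left,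
      Θs = Θ.pullback (X' := (A.fibre s).toAbelianVariety.X.left) (pullback.fst A.X.hom s) := ⟨_, rfl⟩
  refine ⟨Θs, by rw [hΘs_def]; exact hΘ.pullback _, ?_⟩
  rw [hΘs_def, CartierDivisor.cechClass_pullback, ← detClass_lineBundle_toUnitCocycle Θ]
  rfl

/-! ## §2 `K(L)` is a finite closed subgroup scheme of `A`, for that `L` -/

/-- **On an abelian scheme `A → Spec k` over a field there is a rank-one rigidified `L`, of ample class on every geometric fibre, whose `K(L)` is a
FINITE CLOSED SUBGROUP SCHEME of `A`**: a closed immersion `i : Z ↪ A` with `Z → Spec k` finite whose `T`-points are exactly the `u : T → A` with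
`u ∈ K(L)` ([MumfordAV1970] §13 (p. 123): `K(L)` closed, and FINITE since `L` is ample on geometric fibres, §6 Application 1; ★
`exists_isClosedImmersion_isFinite_iff_memKOfL_of_isNoetherianRing`), through which the unit, the product of the two projections and the inverse factor
(★ `exists_one_mul_inv_fac_of_memKOfL`: `K(L)(T) ≤ A(T)` is a subgroup).  Any characteristic; no `n ∈ k^×`, no étaleness of `K(L)`.
[cite: MumfordAV1970, §13 (p. 123) and §6 Application 1 (p. 60)] [cite: GortzWedhorn2023, Thm. 24.66 (p. 405; proof pp. 407–408)] -/
theorem exists_rankOne_kOfL_closedSubgroup (k : Type) [Field k] (A : AbelianSchemeOver (Spec (.of k))) :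
    ∃ (L : A.left.Modules) (hL : HasRank L 1) (_ : CechPic.pullback A.unitSection (detClass (HasRank.isFiniteLocallyFree' hL)) = 1)
      (_ : ∀ ⦃Ω : Type⦄ [Field Ω] [IsAlgClosed Ω] (s : Spec (.of Ω) ⟶ Spec (.of k)),
        ∃ Θ : CartierDivisor (A.fibre s).toAbelianVariety.X.left, Θ.IsAmple ∧
          CechPic.pullback (X := (A.fibre s).toAbelianVariety.X.left) (pullback.fst A.X.hom s)
            (detClass (HasRank.isFiniteLocallyFree' hL)) = Θ.cechClass)
      (Z : Over (Spec (.of k))) (i : Z ⟶ A.X) (_ : IsClosedImmersion i.left) (_ : IsFinite Z.hom),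
      (∀ (T : Over (Spec (.of k))) (u : T ⟶ A.X), (∃ v : T ⟶ Z, v ≫ i = u) ↔ A.MemKOfL L u) ∧
      (∃ e : 𝟙_ (Over (Spec (.of k))) ⟶ Z, e ≫ i = 1) ∧
      (∃ m : Z ⊗ Z ⟶ Z, m ≫ i = (fst Z Z ≫ i) * (snd Z Z ≫ i)) ∧ ∃ n : Z ⟶ Z, n ≫ i = i⁻¹ := by
  obtain ⟨L, hL, hε, hΘ⟩ := A.exists_rankOne_rigidified_isAmple_geometricFibre k
  obtain ⟨Z, i, hci, hZfin, hZ⟩ := A.exists_isClosedImmersion_isFinite_iff_memKOfL_of_isNoetherianRing hL hε hΘ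
  exact ⟨L, hL, hε, hΘ, Z, i, hci, hZfin, hZ, A.exists_one_mul_inv_fac_of_memKOfL i hL hε hZ⟩

/-! ## §3 The head for FLAT Poincaré data, minimal binders -/

/-- **[MumfordAV1970] §13 Cor. 2 FROM FLAT POINCARÉ DATA, minimal binders**: over `K = K̄`, for `π : A → Â` a FLAT surjective homomorphism of abelian
schemes of relative dimension `g` with kernel `K(L)` (`L` rank one, rigidified) and `𝒫` rank one on `A × Â` with `(1 × π)^*𝒫 ≅ Λ(L)` and every slice
`𝒫|_{A × {b}}` in `Pic⁰`: for EVERY finite affine open cover `𝔘` of `A`, `Ȟ¹(𝔘, 𝒪_A)` is a finite `K`-module of rank `g` — ★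
`finite_finrank_cechH1_eq_of_poincareData` with its four structural instances on `A → Spec K` (proper, geometrically integral, flat, universally open)
discharged from `AbelianSchemeOver`.  The shape of `A → A⁄K(L)` when `K(L)` is NOT étale ([MumfordAV1970] §12 Thm. 1: `π` finite flat surjective).
[cite: MumfordAV1970, §13 Cor. 2 (p. 129), the proof of the Theorem (pp. 125–129) and §12 Thm. 1 (p. 111)] -/
theorem finite_finrank_cechH1_eq_of_poincareData_of_flat {K : Type} [Field K] [IsAlgClosed K] (A hat : AbelianSchemeOver (Spec (.of K)))
    (π : A.X ⟶ hat.X) [IsMonHom π] [Flat π.left] [Surjective π.left] {L : A.left.Modules} (hL : HasRank L 1)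
    (hε : CechPic.pullback A.unitSection (detClass (HasRank.isFiniteLocallyFree' hL)) = 1)
    (hker : ∀ (T : Over (Spec (.of K))) (u : T ⟶ A.X), u ≫ π = 1 ↔ A.MemKOfL L u)
    (P : (A.prodLeft hat).Modules) (hsock : Nonempty ((Scheme.Modules.pullback (A.X ◁ π).left).obj P ≅ A.mumfordBundle L)) (hP1 : HasRank P 1)
    (hpic : ∀ b : Spec (.of K) ⟶ hat.X.left,
      IsHomogeneous (A.fibre (b ≫ hat.X.hom)).toAbelianVariety ((Scheme.Modules.pullback (A.fibreSlice hat b)).obj P))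
    {g : ℕ} (hA : A.IsOfRelDim g) (hhat : hat.IsOfRelDim g)
    {J : Type} [Finite J] (U : J → A.X.left.Opens) (hU : ∀ i, IsAffineOpen (U i)) (hUcov : iSup U = ⊤) :
    Module.Finite K (CechH1 A.X.hom U) ∧ Module.finrank K (CechH1 A.X.hom U) = g := by
  haveI : IsProper A.X.hom := A.isProper
  haveI : Smooth A.X.hom := A.isSmooth
  haveI : GeometricallyIntegral A.X.hom := A.geometricallyIntegral_hom_overBase
  haveI : Flat A.X.hom := inferInstance
  haveI : LocallyOfFinitePresentation A.X.hom := inferInstance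
  haveI : UniversallyOpen A.X.hom := inferInstance
  exact A.finite_finrank_cechH1_eq_of_poincareData hat π hL hε hker P hsock hP1 hpic hA hhat U hU hUcov

end AbelianSchemeOver

namespace MumfordDual

/-! ## §4 (DESC) `dim_k Ȟ¹(𝔘, 𝒪_B) = dim B` for every abelian variety, from flat Poincaré data over algebraically closed fields -/

/-- **`dim_k Ȟ¹(𝔘, 𝒪_B) = dim B` FOR EVERY ABELIAN SCHEME `B` OVER EVERY FIELD `k`, FROM FLAT POINCARÉ DATA OVER ALGEBRAICALLY CLOSED FIELDS**
([MumfordAV1970] §13 Cor. 2): IF every abelian scheme `A → Spec K` over an algebraically closed field, of relative dimension `g`, carries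
`(L, Â, π, 𝒫)` — `L` rank one rigidified along the unit section, `π : A → Â` a flat surjective homomorphism onto an abelian scheme of relative dimension
`g` with kernel `K(L)`, `𝒫` rank one on `A × Â` with every slice `𝒫|_{A × {b}}` in `Pic⁰` and `(1 × π)^*𝒫 ≅ Λ(L)` (the output of [MumfordAV1970] §13
Theorem for `Â := A⁄K(L)`, §12 Thm. 1) — THEN `Ȟ¹(𝔘, 𝒪_B)` is a finite `k`-module of rank `dim B` for every finite affine open cover `𝔘` of every
abelian scheme `B → Spec k`: (DESC) ★ `finrank_cechH1_structureSheaf_eq_dim_of_algClosure` to `k̄` ([StacksProject] Tag 02KH; `B_{k̄}` as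
`AbelianSchemeOver.baseChange` and as ★ `AbelianVariety.baseChange` agree by `rfl`) + §3 at `B_{k̄}` with the hypothesis' data.
[cite: MumfordAV1970, §13 Cor. 2 (p. 129), §13 Theorem (p. 125) and §12 Thm. 1 (p. 111)] [cite: StacksProject, Tag 02KH] -/
theorem finite_finrank_cechH1_eq_dim_of_forall_flatPoincareData
    (hMD : ∀ (K : Type) [Field K] [IsAlgClosed K] (A : AbelianSchemeOver (Spec (.of K))) (g : ℕ), A.IsOfRelDim g →
      ∃ (L : A.left.Modules) (hL : HasRank L 1) (_ : CechPic.pullback A.unitSection (detClass (HasRank.isFiniteLocallyFree' hL)) = 1)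
        (hat : AbelianSchemeOver (Spec (.of K))) (_ : hat.IsOfRelDim g) (π : A.X ⟶ hat.X) (_ : IsMonHom π) (_ : Flat π.left)
        (_ : Surjective π.left) (P : (A.prodLeft hat).Modules) (_ : HasRank P 1),
        (∀ (T : Over (Spec (.of K))) (u : T ⟶ A.X), u ≫ π = 1 ↔ A.MemKOfL L u) ∧
        (∀ b : Spec (.of K) ⟶ hat.X.left,
          IsHomogeneous (A.fibre (b ≫ hat.X.hom)).toAbelianVariety ((Scheme.Modules.pullback (A.fibreSlice hat b)).obj P)) ∧
        Nonempty ((Scheme.Modules.pullback (A.X ◁ π).left).obj P ≅ A.mumfordBundle L))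
    (k : Type) [Field k] (B : AbelianSchemeOver (Spec (.of k))) {I : Type} [Finite I] (V : I → B.X.left.Opens)
    (hV : ∀ j, IsAffineOpen (V j)) (hVcov : iSup V = ⊤) :
    Module.Finite k (CechH1 B.X.hom V) ∧ Module.finrank k (CechH1 B.X.hom V) = B.toAffine.toAbelianVariety.dim := by
  classical
  obtain ⟨g, hg⟩ := B.exists_isOfRelDim
  -- `B_{k̄}`: the `AbelianSchemeOver` base change IS the ★ `AbelianVariety.baseChange`
  have hW : (B.baseChange (Spec.map (CommRingCat.ofHom (algebraMap k (AlgebraicClosure k))))).toAffine.toAbelianVariety =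
      B.toAffine.toAbelianVariety.baseChange (AlgebraicClosure k) := rfl
  have hdim : (B.baseChange (Spec.map (CommRingCat.ofHom (algebraMap k (AlgebraicClosure k))))).toAffine.toAbelianVariety.dim = g :=
    AbelianSchemeOver.dim_toAbelianVariety_of_isOfRelDim (hg.baseChange _)
  -- §3 at `B_{k̄}` with the hypothesis' flat Poincaré data, in the tokens of (DESC)
  have key : ∀ {κ' : Type} [Finite κ']
      (U' : κ' → (B.baseChange (Spec.map (CommRingCat.ofHom (algebraMap k (AlgebraicClosure k))))).toAffine.toAbelianVariety.X.left.Opens),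
      (∀ i, IsAffineOpen (U' i)) → iSup U' = ⊤ →
      Module.Finite (AlgebraicClosure k)
          (CechH1 (B.baseChange (Spec.map (CommRingCat.ofHom (algebraMap k (AlgebraicClosure k))))).toAffine.toAbelianVariety.X.hom U') ∧
        Module.finrank (AlgebraicClosure k)
          (CechH1 (B.baseChange (Spec.map (CommRingCat.ofHom (algebraMap k (AlgebraicClosure k))))).toAffine.toAbelianVariety.X.hom U') =
          (B.baseChange (Spec.map (CommRingCat.ofHom (algebraMap k (AlgebraicClosure k))))).toAffine.toAbelianVariety.dim := by
    intro κ' _ U' hU' hU'cov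
    rw [hdim]
    obtain ⟨L, hL, hε, hat, hhat, π, hπmon, hπflat, hπsurj, P, hP1, hker, hpic, hsock⟩ :=
      hMD (AlgebraicClosure k) (B.baseChange (Spec.map (CommRingCat.ofHom (algebraMap k (AlgebraicClosure k))))) g (hg.baseChange _)
    haveI := hπmon
    haveI := hπflat
    haveI := hπsurj
    exact (B.baseChange (Spec.map (CommRingCat.ofHom (algebraMap k (AlgebraicClosure k))))).finite_finrank_cechH1_eq_of_poincareData_of_flat
      hat π hL hε hker P hsock hP1 hpic (hg.baseChange _) hhat U' hU' hU'cov
  rw [hW] at key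
  -- (DESC)
  exact AbelianVarieties.finrank_cechH1_structureSheaf_eq_dim_of_algClosure B.toAffine.toAbelianVariety key V hV hVcov

/-- **THE `hH1` LETTER OF JUNCTION §1b (`stub_L4B1uH_abelianLiftOfCechH1Count` ∕ `stub_L4B1u_of_cechH1Count` of `Lines/F0_P6b_BTSerreTate.lean`), FROM
FLAT POINCARÉ DATA OVER ALGEBRAICALLY CLOSED FIELDS**: under the hypothesis of the previous theorem, `dim B ≤ dim_k Ȟ¹(𝔘, 𝒪_B) + 1` for every abelian
scheme `B` over every field `k` and every finite affine open cover `𝔘` of `B` — VERBATIM the binder `hH1`; the previous theorem gives equality.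
[cite: MumfordAV1970, §13 Cor. 2 (p. 129), §13 Theorem (p. 125) and §12 Thm. 1 (p. 111)] -/
theorem hH1_of_forall_flatPoincareData
    (hMD : ∀ (K : Type) [Field K] [IsAlgClosed K] (A : AbelianSchemeOver (Spec (.of K))) (g : ℕ), A.IsOfRelDim g →
      ∃ (L : A.left.Modules) (hL : HasRank L 1) (_ : CechPic.pullback A.unitSection (detClass (HasRank.isFiniteLocallyFree' hL)) = 1)
        (hat : AbelianSchemeOver (Spec (.of K))) (_ : hat.IsOfRelDim g) (π : A.X ⟶ hat.X) (_ : IsMonHom π) (_ : Flat π.left)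
        (_ : Surjective π.left) (P : (A.prodLeft hat).Modules) (_ : HasRank P 1),
        (∀ (T : Over (Spec (.of K))) (u : T ⟶ A.X), u ≫ π = 1 ↔ A.MemKOfL L u) ∧
        (∀ b : Spec (.of K) ⟶ hat.X.left,
          IsHomogeneous (A.fibre (b ≫ hat.X.hom)).toAbelianVariety ((Scheme.Modules.pullback (A.fibreSlice hat b)).obj P)) ∧
        Nonempty ((Scheme.Modules.pullback (A.X ◁ π).left).obj P ≅ A.mumfordBundle L)) :
    ∀ (k : Type) [Field k] (B : AbelianSchemeOver (Spec (.of k))) {I : Type} [Finite I] (V : I → B.X.left.Opens),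
      (∀ j, IsAffineOpen (V j)) → iSup V = ⊤ → B.toAffine.toAbelianVariety.dim ≤ Module.finrank k (CechH1 B.X.hom V) + 1 := by
  intro k _ B I _ V hV hVcov
  rw [(finite_finrank_cechH1_eq_dim_of_forall_flatPoincareData hMD k B V hV hVcov).2]
  exact Nat.le_succ _

end MumfordDual

end Literature.AlgebraicGeometry.AbelianSchemes

end
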